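import Summits.QuantumFields.YangMills.Theorems.F4SubCurvatureDoorFibreDichotomyInvariantMoments
import Mathlib
import HarnessLib

/-!
# OddModeRigidity / R-O1 «ANALYTIC HALF» — helper: the shell-orthogonal projection onto harmonic homogeneous polynomials

Crux ⟨stmt-QuantumFields-23035⟩ `F4SubCurvatureDoor.ShortRootRigidity`, stub `:146 stub_oddModeRigidity`, typed split
`Cruxes/ShortRootRigidity/Lines/odd_mode_split.lean` (ym-idea-3 g21), piece `AnalyticHalf` («degree-wise spherical-harmonic projection of a
continuous class kernel commutes with the `O(4)` action»).  This file supplies the projection, with no analyticity and no surface measure: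
for a function `g` integrable on a shell `S = {a < ‖x‖ < b}` and a degree `L`, the finite-dimensional space `Harm_L` of harmonic homogeneous
polynomials of degree `L` carries the positive definite form `∫_S p q`, so the functional `q ↦ ∫_S q g` has a Riesz vector `v ∈ Harm_L`:

* `eq_zero_of_shell_sq_integral_eq_zero` — a homogeneous polynomial with `∫_S p² = 0` is `0`;
* `exists_harmonicProjection` — `∃ v ∈ Harm_L, ∀ q ∈ Harm_L, ∫_S q·g = ∫_S q·v`;
* `harmonicProjection_comp_iso` — EQUIVARIANCE: then `∫_S q·(g∘A) = ∫_S q·(v∘A)` for every linear isometry `A` of `ℝ⁴` and `q ∈ Harm_L`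
  (substitution + `Harm_L ∘ A = Harm_L`, ✓`toFun_aevalIso`, ✓`iso_preimage_shell`);
* `toFun_eq_zero_of_shell_orthogonal` — UNIQUENESS: `w ∈ Harm_L` with `∫_S q·w = 0` for all `q ∈ Harm_L` is `0`.

Mathlib + tree only (the B4 machinery ✓p723436/✓p723580); no `sorry`; no definitions.  HONEST LABEL: helper for one piece
(`AnalyticHalf`) of the OPEN stub `:146`; `OddModeRigidity`, ⟨23035⟩, ⟨23125⟩, R2d and the Yang–Mills mass gap remain OPEN; no summit is
proved by a line.  Seat `ym-line-frs-p2` g16 (cell ym-idea-3, free hands).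
-/

noncomputable section

open MeasureTheory MeasureTheory.Measure Set Function Filter Topology Metric Module
open scoped BigOperators

namespace Summit.QuantumFields.YangMills.Theorems.F4SubCurvatureDoorAnalyticHalfProof

open MvPolynomial (aeval X)
open Literature.Analysis.Calculus.MvPoly (toFun lap lap_add lap_smul contDiff_toFun toFun_smul_of_isHomogeneous toFun_mul toFun_add
  toFun_smul toFun_zero)
open Summit.QuantumFields.YangMills.Theorems.F4SubCurvatureDoorLaplaceFourierRegistered (E4)
open Summit.QuantumFields.YangMills.Theorems.F4SubCurvatureDoorHarmonicMomentODE (toFun_aevalIso isHomogeneous_aevalIso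
  lap_aevalIso_eq_zero setIntegral_comp_iso_of_preimage_eq iso_preimage_shell)

/-! ## Integrability on shells -/

/-- Products of polynomial functions are integrable on a bounded shell. -/
theorem integrableOn_toFun_mul_shell (P Q : MvPolynomial (Fin 4) ℝ) (a b : ℝ) :
    IntegrableOn (fun x : E4 => toFun P x * toFun Q x) {x : E4 | a < ‖x‖ ∧ ‖x‖ < b} volume :=
  ((((contDiff_toFun (m := 0) P).continuous.mul (contDiff_toFun (m := 0) Q).continuous).continuousOn).integrableOn_compact
    (isCompact_closedBall (0 : E4) b)).mono_set fun x hx => by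
      rw [mem_closedBall, dist_zero_right]; exact hx.2.le

/-- A polynomial function times a function integrable on a bounded shell is integrable there. -/
theorem integrableOn_toFun_mul {g : E4 → ℝ} {a b : ℝ} (hg : IntegrableOn g {x : E4 | a < ‖x‖ ∧ ‖x‖ < b} volume)
    (P : MvPolynomial (Fin 4) ℝ) : IntegrableOn (fun x : E4 => toFun P x * g x) {x : E4 | a < ‖x‖ ∧ ‖x‖ < b} volume := by
  have hc : Continuous (toFun P) := (contDiff_toFun (m := 0) P).continuous
  obtain ⟨C, hC⟩ := (isCompact_closedBall (0 : E4) b).exists_bound_of_continuousOn hc.continuousOn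
  have hmeas : MeasurableSet {x : E4 | a < ‖x‖ ∧ ‖x‖ < b} :=
    (measurableSet_lt measurable_const measurable_norm).inter (measurableSet_lt measurable_norm measurable_const)
  refine Integrable.bdd_mul (c := C) hg hc.aestronglyMeasurable.restrict ?_
  exact (ae_restrict_iff' hmeas).2 (Eventually.of_forall fun x hx => hC x (by rw [mem_closedBall, dist_zero_right]; exact hx.2.le))

/-! ## Positivity: a homogeneous polynomial square-null on a shell vanishes -/

/-- **A homogeneous polynomial with `∫_{a<‖x‖<b} p² = 0` is zero** (`0 < a < b`). -/
theorem eq_zero_of_shell_sq_integral_eq_zero {p : MvPolynomial (Fin 4) ℝ} {L : ℕ} (hp : p.IsHomogeneous L) {a b : ℝ}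
    (ha : 0 < a) (hab : a < b) (h0 : ∫ x in {x : E4 | a < ‖x‖ ∧ ‖x‖ < b}, toFun p x * toFun p x = 0) : p = 0 := by
  have hc : Continuous (toFun p) := (contDiff_toFun (m := 0) p).continuous
  set S : Set E4 := {x : E4 | a < ‖x‖ ∧ ‖x‖ < b} with hS
  have hSo : IsOpen S := (isOpen_lt continuous_const continuous_norm).inter (isOpen_lt continuous_norm continuous_const)
  -- the support of `p²` meets the shell in an open null set, hence in the empty set
  have hsupp : volume (Function.support (fun x : E4 => toFun p x * toFun p x) ∩ S) = 0 := by
    have h := (setIntegral_pos_iff_support_of_nonneg_ae (Eventually.of_forall fun x => mul_self_nonneg (toFun p x))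
      (integrableOn_toFun_mul_shell p p a b)).not
    rw [h0, lt_self_iff_false, not_false_eq_true, true_iff, not_lt] at h
    exact le_antisymm h zero_le
  have hopen : IsOpen (Function.support (fun x : E4 => toFun p x * toFun p x) ∩ S) := ((hc.mul hc).isOpen_support).inter hSo
  have hempty := (hopen.measure_eq_zero_iff volume).1 hsupp
  have hshell : ∀ x : E4, a < ‖x‖ → ‖x‖ < b → toFun p x = 0 := by
    intro x h1 h2
    by_contra h
    have hmem : x ∈ Function.support (fun x : E4 => toFun p x * toFun p x) ∩ S :=
      ⟨by simpa [Function.mem_support] using h, ⟨h1, h2⟩⟩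
    rw [hempty] at hmem
    exact hmem
  -- by homogeneity `p` vanishes off the origin, by continuity everywhere
  have hoff : ∀ x : E4, x ≠ 0 → toFun p x = 0 := by
    intro x hx
    have hxn : 0 < ‖x‖ := norm_pos_iff.2 hx
    set t : ℝ := (a + b) / 2 / ‖x‖ with ht
    have htpos : 0 < t := div_pos (by linarith) hxn
    have hnorm : ‖t • x‖ = (a + b) / 2 := by
      rw [norm_smul, Real.norm_eq_abs, abs_of_pos htpos, ht, div_mul_cancel₀ _ hxn.ne']
    have h := toFun_smul_of_isHomogeneous hp t x
    rw [hshell _ (by rw [hnorm]; linarith) (by rw [hnorm]; linarith)] at h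
    exact (mul_eq_zero.1 h.symm).resolve_left (pow_ne_zero _ htpos.ne')
  have hall : ∀ x : E4, toFun p x = 0 := by
    have hcl : IsClosed {x : E4 | toFun p x = 0} := isClosed_eq hc continuous_const
    have hsub : ({0}ᶜ : Set E4) ⊆ {x : E4 | toFun p x = 0} := fun x hx => hoff x hx
    have hd : Dense ({0}ᶜ : Set E4) := dense_compl_singleton 0
    have huniv : {x : E4 | toFun p x = 0} = univ := by
      have := hcl.closure_subset_iff.2 hsub
      rw [hd.closure_eq] at this
      exact eq_univ_of_univ_subset this
    intro x
    have hx : x ∈ {x : E4 | toFun p x = 0} := by rw [huniv]; exact mem_univ x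
    exact hx
  refine MvPolynomial.funext fun y => ?_
  have h := hall (WithLp.toLp 2 y)
  simpa [toFun] using h

/-- **Uniqueness**: a harmonic homogeneous polynomial of degree `L` shell-orthogonal to all of `Harm_L` is zero. -/
theorem eq_zero_of_shell_orthogonal {w : MvPolynomial (Fin 4) ℝ} {L : ℕ} (hw : w.IsHomogeneous L) (hlw : lap w = 0) {a b : ℝ}
    (ha : 0 < a) (hab : a < b)
    (horth : ∀ q : MvPolynomial (Fin 4) ℝ, q.IsHomogeneous L → lap q = 0 →
      ∫ x in {x : E4 | a < ‖x‖ ∧ ‖x‖ < b}, toFun q x * toFun w x = 0) : w = 0 :=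
  eq_zero_of_shell_sq_integral_eq_zero hw ha hab (horth w hw hlw)

/-! ## Existence: the Riesz vector of `q ↦ ∫_S q g` on `Harm_L` -/

/-- **The harmonic projection exists.**  For `g` integrable on the shell `S = {a<‖x‖<b}` (`0<a<b`) and a degree `L` there is a harmonic
homogeneous polynomial `v` of degree `L` with `∫_S q·g = ∫_S q·v` for every harmonic homogeneous `q` of degree `L`. -/
theorem exists_harmonicProjection {g : E4 → ℝ} {a b : ℝ} (ha : 0 < a) (hab : a < b)
    (hg : IntegrableOn g {x : E4 | a < ‖x‖ ∧ ‖x‖ < b} volume) (L : ℕ) :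
    ∃ v : MvPolynomial (Fin 4) ℝ, v.IsHomogeneous L ∧ lap v = 0 ∧
      ∀ q : MvPolynomial (Fin 4) ℝ, q.IsHomogeneous L → lap q = 0 →
        ∫ x in {x : E4 | a < ‖x‖ ∧ ‖x‖ < b}, toFun q x * g x = ∫ x in {x : E4 | a < ‖x‖ ∧ ‖x‖ < b}, toFun q x * toFun v x := by
  set S : Set E4 := {x : E4 | a < ‖x‖ ∧ ‖x‖ < b} with hS
  -- the space `W = Harm_L`
  let lapL : MvPolynomial (Fin 4) ℝ →ₗ[ℝ] MvPolynomial (Fin 4) ℝ :=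
    { toFun := lap, map_add' := lap_add, map_smul' := fun c Q => by rw [lap_smul]; rfl }
  let W : Submodule ℝ (MvPolynomial (Fin 4) ℝ) := MvPolynomial.homogeneousSubmodule (Fin 4) ℝ L ⊓ LinearMap.ker lapL
  have memW : ∀ Q : MvPolynomial (Fin 4) ℝ, Q ∈ W ↔ Q.IsHomogeneous L ∧ lap Q = 0 := fun Q => by
    simp only [W, Submodule.mem_inf, MvPolynomial.mem_homogeneousSubmodule, LinearMap.mem_ker]
    rfl
  haveI : FiniteDimensional ℝ W := by
    have hle : W ≤ MvPolynomial.restrictTotalDegree (Fin 4) ℝ L := fun Q hQ => by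
      rw [MvPolynomial.mem_restrictTotalDegree]
      exact ((memW Q).1 hQ).1.totalDegree_le
    exact Submodule.finiteDimensional_of_le hle
  -- the positive form `B(p,q) = ∫_S p q`
  have hIb : ∀ p q : W, IntegrableOn (fun x : E4 => toFun (p : MvPolynomial (Fin 4) ℝ) x * toFun (q : MvPolynomial (Fin 4) ℝ) x)
      S volume := fun p q => integrableOn_toFun_mul_shell _ _ a b
  let B : W →ₗ[ℝ] W →ₗ[ℝ] ℝ := LinearMap.mk₂ ℝ
    (fun p q : W => ∫ x in S, toFun (p : MvPolynomial (Fin 4) ℝ) x * toFun (q : MvPolynomial (Fin 4) ℝ) x)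
    (fun p₁ p₂ q => by
      simp only [Submodule.coe_add, toFun_add, add_mul]
      exact integral_add (hIb p₁ q) (hIb p₂ q))
    (fun c p q => by
      simp only [Submodule.coe_smul, toFun_smul, mul_assoc, smul_eq_mul]
      exact integral_const_mul c _)
    (fun p q₁ q₂ => by
      simp only [Submodule.coe_add, toFun_add, mul_add]
      exact integral_add (hIb p q₁) (hIb p q₂))
    (fun c p q => by
      simp only [Submodule.coe_smul, toFun_smul, smul_eq_mul, mul_left_comm _ c]
      exact integral_const_mul c _)
  have B_apply : ∀ p q : W, B p q =
      ∫ x in S, toFun (p : MvPolynomial (Fin 4) ℝ) x * toFun (q : MvPolynomial (Fin 4) ℝ) x := fun p q => rfl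
  -- the functional `Λ(q) = ∫_S q g`
  have hIg : ∀ q : W, IntegrableOn (fun x : E4 => toFun (q : MvPolynomial (Fin 4) ℝ) x * g x) S volume :=
    fun q => integrableOn_toFun_mul hg _
  let Λ : W →ₗ[ℝ] ℝ :=
    { toFun := fun q => ∫ x in S, toFun (q : MvPolynomial (Fin 4) ℝ) x * g x
      map_add' := fun q₁ q₂ => by
        simp only [Submodule.coe_add, toFun_add, add_mul]
        exact integral_add (hIg q₁) (hIg q₂)
      map_smul' := fun c q => by
        simp only [Submodule.coe_smul, toFun_smul, RingHom.id_apply, smul_eq_mul, mul_assoc]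
        exact integral_const_mul c _ }
  have Λ_apply : ∀ q : W, Λ q = ∫ x in S, toFun (q : MvPolynomial (Fin 4) ℝ) x * g x := fun q => rfl
  -- `B : W → W*` is injective (positivity), hence surjective
  have hinj : Function.Injective B := by
    intro p₁ p₂ h12
    by_contra hne
    have hd : (p₁ - p₂ : W) ≠ 0 := sub_ne_zero.2 hne
    have hd' : ((p₁ - p₂ : W) : MvPolynomial (Fin 4) ℝ) ≠ 0 := fun h0 => hd (Subtype.ext h0)
    have hB0 : B (p₁ - p₂) = 0 := by rw [map_sub, h12, sub_self]
    have hBd : B (p₁ - p₂) (p₁ - p₂) = 0 := by rw [hB0, LinearMap.zero_apply]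
    rw [B_apply] at hBd
    exact hd' (eq_zero_of_shell_sq_integral_eq_zero ((memW _).1 (p₁ - p₂).2).1 ha hab hBd)
  have hsurj : Function.Surjective B :=
    (LinearMap.injective_iff_surjective_of_finrank_eq_finrank (Subspace.dual_finrank_eq).symm).1 hinj
  obtain ⟨v, hv⟩ := hsurj Λ
  obtain ⟨hvh, hvl⟩ := (memW _).1 v.2
  refine ⟨(v : MvPolynomial (Fin 4) ℝ), hvh, hvl, fun q hq hlq => ?_⟩
  have h := LinearMap.congr_fun hv ⟨q, (memW q).2 ⟨hq, hlq⟩⟩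
  rw [B_apply, Λ_apply] at h
  -- `B v q = Λ q`
  rw [← h]
  exact integral_congr_ae (ae_of_all _ fun x => mul_comm _ _)

/-! ## Equivariance under linear isometries -/

/-- **The harmonic projection is isometry-equivariant.**  If `v` is the shell projection of `g` in degree `L`, then for every linear
isometry `A` of `ℝ⁴` and every harmonic homogeneous `q` of degree `L`, `∫_S q·(g∘A) = ∫_S q·(v∘A)`
(substitute `y = Ax`; the shell and Lebesgue measure are `A`-invariant and `q∘A⁻¹ ∈ Harm_L`). -/
theorem harmonicProjection_comp_iso {g : E4 → ℝ} {a b : ℝ} {L : ℕ} {v : MvPolynomial (Fin 4) ℝ}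
    (hv : ∀ q : MvPolynomial (Fin 4) ℝ, q.IsHomogeneous L → lap q = 0 →
      ∫ x in {x : E4 | a < ‖x‖ ∧ ‖x‖ < b}, toFun q x * g x = ∫ x in {x : E4 | a < ‖x‖ ∧ ‖x‖ < b}, toFun q x * toFun v x)
    (A : E4 ≃ₗᵢ[ℝ] E4) {q : MvPolynomial (Fin 4) ℝ} (hq : q.IsHomogeneous L) (hlq : lap q = 0) :
    ∫ x in {x : E4 | a < ‖x‖ ∧ ‖x‖ < b}, toFun q x * g (A x) =
      ∫ x in {x : E4 | a < ‖x‖ ∧ ‖x‖ < b}, toFun q x * toFun v (A x) := by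
  set S : Set E4 := {x : E4 | a < ‖x‖ ∧ ‖x‖ < b} with hS
  -- `q ∘ A⁻¹` as a polynomial
  set qA : MvPolynomial (Fin 4) ℝ :=
    aeval (fun i : Fin 4 => ∑ j : Fin 4, (A.symm (EuclideanSpace.single j (1 : ℝ))) i • (X j : MvPolynomial (Fin 4) ℝ)) q with hqA
  have hqA_fun : ∀ y : E4, toFun qA y = toFun q (A.symm y) := fun y => toFun_aevalIso A.symm q y
  have hqAh : qA.IsHomogeneous L := isHomogeneous_aevalIso A.symm hq
  have hqAl : lap qA = 0 := lap_aevalIso_eq_zero A.symm hlq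
  -- substitution `y = A x` on both sides
  have e1 : ∫ x in S, toFun q x * g (A x) = ∫ y in S, toFun qA y * g y := by
    have h := setIntegral_comp_iso_of_preimage_eq A (fun y => toFun qA y * g y) (iso_preimage_shell A a b)
    rw [← h]
    refine integral_congr_ae (ae_of_all _ fun x => ?_)
    simp only [hqA_fun, LinearIsometryEquiv.symm_apply_apply]
  have e2 : ∫ x in S, toFun q x * toFun v (A x) = ∫ y in S, toFun qA y * toFun v y := by
    have h := setIntegral_comp_iso_of_preimage_eq A (fun y => toFun qA y * toFun v y) (iso_preimage_shell A a b)
    rw [← h]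
    refine integral_congr_ae (ae_of_all _ fun x => ?_)
    simp only [hqA_fun, LinearIsometryEquiv.symm_apply_apply]
  rw [e1, e2]
  exact hv qA hqAh hqAl

/-- **Pointwise invariance from the projection.**  If `v ∈ Harm_L` is the shell projection of `g` and `g∘A = g` on `ℝ⁴` for a linear
isometry `A`, then `v∘A = v` (pointwise). -/
theorem harmonicProjection_invariant {g : E4 → ℝ} {a b : ℝ} (ha : 0 < a) (hab : a < b) {L : ℕ} {v : MvPolynomial (Fin 4) ℝ}
    (hvh : v.IsHomogeneous L) (hvl : lap v = 0)
    (hv : ∀ q : MvPolynomial (Fin 4) ℝ, q.IsHomogeneous L → lap q = 0 →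
      ∫ x in {x : E4 | a < ‖x‖ ∧ ‖x‖ < b}, toFun q x * g x = ∫ x in {x : E4 | a < ‖x‖ ∧ ‖x‖ < b}, toFun q x * toFun v x)
    (A : E4 ≃ₗᵢ[ℝ] E4) (hgA : ∀ x : E4, g (A x) = g x) (x : E4) : toFun v (A x) = toFun v x := by
  set S : Set E4 := {x : E4 | a < ‖x‖ ∧ ‖x‖ < b} with hS
  -- `w := v∘A − v ∈ Harm_L` is shell-orthogonal to `Harm_L`
  set vA : MvPolynomial (Fin 4) ℝ :=
    aeval (fun i : Fin 4 => ∑ j : Fin 4, (A (EuclideanSpace.single j (1 : ℝ))) i • (X j : MvPolynomial (Fin 4) ℝ)) v with hvA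
  have hvA_fun : ∀ y : E4, toFun vA y = toFun v (A y) := fun y => toFun_aevalIso A v y
  set w : MvPolynomial (Fin 4) ℝ := vA - v with hw_def
  have hw_e : w = vA + (-1 : ℝ) • v := by rw [hw_def, neg_one_smul, sub_eq_add_neg]
  have hw_fun : ∀ y : E4, toFun w y = toFun v (A y) - toFun v y := fun y => by
    rw [hw_e, toFun_add, toFun_smul, hvA_fun]; ring
  have hw : w.IsHomogeneous L := (isHomogeneous_aevalIso A hvh).sub hvh
  have hlw : lap w = 0 := by
    rw [hw_e, lap_add, lap_smul, lap_aevalIso_eq_zero A hvl, hvl, smul_zero, add_zero]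
  have horth : ∀ q : MvPolynomial (Fin 4) ℝ, q.IsHomogeneous L → lap q = 0 → ∫ x in S, toFun q x * toFun w x = 0 := by
    intro q hq hlq
    have h1 := harmonicProjection_comp_iso hv A hq hlq
    simp_rw [hgA] at h1
    rw [hv q hq hlq] at h1
    -- `h1 : ∫ q v = ∫ q (v∘A)`
    have hint1 : IntegrableOn (fun x : E4 => toFun q x * toFun v (A x)) S volume := by
      have h : IntegrableOn (fun x : E4 => toFun q x * toFun vA x) S volume := integrableOn_toFun_mul_shell _ _ a b
      exact h.congr_fun (fun x _ => by simp only [hvA_fun]) ((measurableSet_lt measurable_const measurable_norm).inter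
        (measurableSet_lt measurable_norm measurable_const))
    have hint2 : IntegrableOn (fun x : E4 => toFun q x * toFun v x) S volume := integrableOn_toFun_mul_shell _ _ a b
    have e : ∫ x in S, toFun q x * toFun w x = (∫ x in S, toFun q x * toFun v (A x)) - ∫ x in S, toFun q x * toFun v x := by
      rw [← integral_sub hint1 hint2]
      refine integral_congr_ae (ae_of_all _ fun x => ?_)
      simp only [hw_fun, mul_sub]
    rw [e, ← h1, sub_self]
  have hzero := eq_zero_of_shell_orthogonal hw hlw ha hab horth
  have h := hw_fun x
  rw [hzero, toFun_zero] at h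
  linarith

end Summit.QuantumFields.YangMills.Theorems.F4SubCurvatureDoorAnalyticHalfProof

end
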